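import Summits.CriticalPhenomena.PercolationContinuityZ3.Theorems.PercNearOneGluingNoHeavyQuantGatedSliceWindowReduction
import HarnessLib

/-!
# QUANT lane R8, T-DEC, leg (III), blob case — dual route, part 4: `GatedSliceWindowDEC` (hence `GatedSliceMixLaw`) ⟹ SDEC (up to any gate
# level) is CLOSED UNDER SLICING BY ANY HEAVY BLOB `{0, a; g}` — the blob case of leg (III) for every `a`

builds on p205010 (kernel theorem, internal audit signed; external expert review pending)

Support file (`--supports stmt-CriticalPhenomena-4575`), QUANT lane typer seat prim-quant-stmt (gen 29), rung R8 of
`run/shared/lean/prim/quant/LADDER.md`.  Theorems only, standard axioms, no sorries, no definitions.  Parts 1–3: `…QuantGatedSliceWindowLayer`,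
`…NoWeak`, `…Reduction` (`gatedSliceWindowDEC_of_mixLaw`); statements `…QuantGatedSliceWindow`.

WHAT.  Typer g27's `sdecUpTo_slice_relay` (a = 1) with the refuted one-layer move replaced by the window form: per gate `q ≤ Q` and layer
`j < M + a`, the window hypotheses of `GatedSliceWindowDEC` for `ν = gate_q μ` (`y = qx`, `S = qT`, `z = 1 − q`) are `SDECUpTo` below `M` and
Theorem A (`decAt_of_top_le`) at and above `M`; its conclusion is `gate_q (slice μ a g) ∈ D(q(T + ag), j)` by the de-gating identity
`slice (gate_q μ) a g + g(1−q)(δ₀ − δ_a) = gate_q (slice μ a g)`.  So **`GatedSliceWindowDEC → (SDECUpTo x Q M μ → SDECUpTo x Q (M+a) (slice μ a g))`**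
for every top-affordable probability law `μ`, every `x ≤ g ≤ 1`, `a ≥ 1` — and the same from `GatedSliceMixLaw`.  HONEST: both hypotheses OPEN
(conjectures typed in `…QuantGatedSliceWindow`); `GateMove`/`GatedConvEmptyFree`/`SingleGateConvClosed`/`TreeDEC`/`FarTreeRow` OPEN.

* `LawDec.gate_slice_move_eq` — the de-gating identity for a general blob.
* **`LawDec.sdecUpTo_slice_blob_of_window : GatedSliceWindowDEC → …`**, **`sdecUpTo_slice_blob_of_mixLaw : GatedSliceMixLaw → …`**,
  `sdec_slice_blob_of_mixLaw` (`Q = 1`).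

[this work]; a = 1: typer g27; SDECUpTo: typer g25 (this lane).  The gluing rows served [cite: KozmaNitzan2024, Conjecture 3 (p. 15)]; product
measure [cite: Grimmett1999, §1.3 p. 10].
-/

noncomputable section

namespace Summit.CriticalPhenomena.PercolationContinuityZ3.Theorems

namespace Quant

open Finset

namespace LawDec

/-- **the de-gating identity for a blob**: `slice (gate_q μ) a g h + g(1−q)([h=0] − [h=a]) = gate_q (slice μ a g) h` (`a ≥ 1`). [this work] -/
theorem gate_slice_move_eq (μ : ℕ → ℝ) (q g : ℝ) (a : ℕ) (ha : 1 ≤ a) (h : ℕ) :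
    slice (gate μ q) a g h + g * (1 - q) * ((if h = 0 then (1 : ℝ) else 0) - (if h = a then (1 : ℝ) else 0))
      = gate (slice μ a g) q h := by
  simp only [gate, slice]
  by_cases h0 : h = 0
  · subst h0
    have hna : ¬ a ≤ 0 := by omega
    have hna' : (0 : ℕ) ≠ a := by omega
    simp only [if_true, if_neg hna, if_neg hna']
    ring
  · by_cases hha : h = a
    · subst hha
      simp only [if_neg h0, le_refl, if_true, Nat.sub_self]
      ring
    · by_cases hah : a ≤ h
      · have h1 : h - a ≠ 0 := by omega
        simp only [if_neg h0, if_neg hha, if_pos hah, if_neg h1]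
        ring
      · simp only [if_neg h0, if_neg hha, if_neg hah]
        ring

/-- **SDEC-UP-TO-`Q` IS CLOSED UNDER SLICING BY A HEAVY BLOB, given the window form `GatedSliceWindowDEC`.**  `μ` a top-affordable probability
law on `{0..M}`, SDEC up to `Q` at floor `x` (`0 < x`, `Q ≤ 1`, `Qx < 1`), `x ≤ g ≤ 1`, `1 ≤ a` ⟹ `slice μ a g` is SDEC up to `Q` at `x` on
`{0..M+a}`.  Per gate `q ≤ Q` and layer `j < M + a`: window hypotheses for `gate_q μ` from `SDECUpTo` (layers `< M`) and Theorem A (layers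
`≥ M`), then `GatedSliceWindowDEC` and `gate_slice_move_eq`. [this work] -/
theorem sdecUpTo_slice_blob_of_window (hW : GatedSliceWindowDEC) (x Q g : ℝ) (M a : ℕ) (μ : ℕ → ℝ) (hx0 : 0 < x) (hQ1 : Q ≤ 1)
    (hQx : Q * x < 1) (hxg : x ≤ g) (hg1 : g ≤ 1) (ha : 1 ≤ a) (hμ0 : ∀ h, 0 ≤ μ h) (hμM : ∀ h, M < h → μ h = 0)
    (hμ1 : ∑ h ∈ Finset.range (M + 1), μ h = 1)
    (hta : x * (M : ℝ) ≤ ∑ h ∈ Finset.range (M + 1), (h : ℝ) * μ h)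
    (hS : SDECUpTo x Q M μ) :
    SDECUpTo x Q (M + a) (slice μ a g) := by
  intro q hq0 hqQ j hj
  set T : ℝ := ∑ h ∈ Finset.range (M + 1), (h : ℝ) * μ h with hT
  set y : ℝ := q * x with hy
  have hq1 : q ≤ 1 := hqQ.trans hQ1
  have hy0 : 0 < y := mul_pos hq0 hx0
  have hy1 : y < 1 := lt_of_le_of_lt (mul_le_mul_of_nonneg_right hqQ hx0.le) hQx
  have hyqg : y ≤ (1 - (1 - q)) * g := by
    rw [hy, show (1 : ℝ) - (1 - q) = q by ring]
    exact mul_le_mul_of_nonneg_left hxg hq0.le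
  obtain ⟨n0, nM, n1⟩ := gate_laws M μ q hq0.le hq1 hμ0 hμM hμ1
  have nmean : ∑ h ∈ Finset.range (M + 1), (h : ℝ) * gate μ q h = q * T := sum_mul_gate μ q M
  have htaν : y * (M : ℝ) ≤ q * T := by rw [hy, mul_assoc]; exact mul_le_mul_of_nonneg_left hta hq0.le
  have hzν : 1 - q ≤ gate μ q 0 := by
    have e : gate μ q 0 = q * μ 0 + (1 - q) := by simp [gate]
    rw [e]; nlinarith [hμ0 0]
  -- the window hypotheses for `gate_q μ` at target `qT`
  have hwin : ∀ i, i ≤ j → j ≤ i + a → DECAtT y (q * T) i M (gate μ q) := by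
    intro i _ _
    by_cases hiM : i < M
    · have := hS q hq0 hqQ i hiM
      rwa [decAt_iff_decAtT, nmean] at this
    · have htop : ∀ h, 0 < gate μ q h → y * (h : ℝ) ≤ ∑ k ∈ Finset.range (M + 1), (k : ℝ) * gate μ q k := by
        intro h hh
        have hhM : h ≤ M := by
          by_contra hc
          exact (ne_of_gt hh) (nM h (not_le.1 hc))
        rw [nmean]
        have : y * (h : ℝ) ≤ y * M := mul_le_mul_of_nonneg_left (by exact_mod_cast hhM) hy0.le
        linarith
      have := decAt_of_top_le M (gate μ q) n0 nM n1 y hy1 htop i (not_lt.1 hiM)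
      rwa [decAt_iff_decAtT, nmean] at this
  have hmove := hW y (1 - q) g (q * T) a j M (gate μ q) hy0 hy1 (by linarith) hzν hg1 hyqg ha n0 nM n1 nmean.symm htaν hj hwin
  have hlaw : (fun h => slice (gate μ q) a g h + g * (1 - q) * ((if h = 0 then (1 : ℝ) else 0) - (if h = a then (1 : ℝ) else 0)))
      = gate (slice μ a g) q := by
    funext h
    exact gate_slice_move_eq μ q g a ha h
  have hsmean : ∑ h ∈ Finset.range (M + a + 1), (h : ℝ) * slice μ a g h = T + (a : ℝ) * g := sum_mul_slice μ a g M hμM hμ1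
  rw [decAt_iff_decAtT, sum_mul_gate, hsmean]
  have et : q * (T + (a : ℝ) * g) = q * T + (a : ℝ) * g - (1 - q) * (a : ℝ) * g := by ring
  rw [et, ← hlaw]
  exact hmove

/-- **the blob case of leg (III) from the law-level mixing statement**: `GatedSliceMixLaw` ⟹ SDEC up to `Q` is closed under slicing by any
heavy blob `{0, a; g}` (`x ≤ g ≤ 1`, `a ≥ 1`). [this work] -/
theorem sdecUpTo_slice_blob_of_mixLaw (hL : GatedSliceMixLaw) (x Q g : ℝ) (M a : ℕ) (μ : ℕ → ℝ) (hx0 : 0 < x) (hQ1 : Q ≤ 1)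
    (hQx : Q * x < 1) (hxg : x ≤ g) (hg1 : g ≤ 1) (ha : 1 ≤ a) (hμ0 : ∀ h, 0 ≤ μ h) (hμM : ∀ h, M < h → μ h = 0)
    (hμ1 : ∑ h ∈ Finset.range (M + 1), μ h = 1)
    (hta : x * (M : ℝ) ≤ ∑ h ∈ Finset.range (M + 1), (h : ℝ) * μ h)
    (hS : SDECUpTo x Q M μ) :
    SDECUpTo x Q (M + a) (slice μ a g) :=
  sdecUpTo_slice_blob_of_window (gatedSliceWindowDEC_of_mixLaw hL) x Q g M a μ hx0 hQ1 hQx hxg hg1 ha hμ0 hμM hμ1 hta hS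

/-- **`Q = 1`**: `GatedSliceMixLaw` ⟹ SDEC is closed under slicing by any heavy blob. [this work] -/
theorem sdec_slice_blob_of_mixLaw (hL : GatedSliceMixLaw) (x g : ℝ) (M a : ℕ) (μ : ℕ → ℝ) (hx0 : 0 < x) (hx1 : x < 1)
    (hxg : x ≤ g) (hg1 : g ≤ 1) (ha : 1 ≤ a) (hμ0 : ∀ h, 0 ≤ μ h) (hμM : ∀ h, M < h → μ h = 0)
    (hμ1 : ∑ h ∈ Finset.range (M + 1), μ h = 1)
    (hta : x * (M : ℝ) ≤ ∑ h ∈ Finset.range (M + 1), (h : ℝ) * μ h) (hS : SDEC x M μ) :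
    SDEC x (M + a) (slice μ a g) := by
  rw [← sdecUpTo_one_iff] at hS ⊢
  exact sdecUpTo_slice_blob_of_mixLaw hL x 1 g M a μ hx0 le_rfl (by rwa [one_mul]) hxg hg1 ha hμ0 hμM hμ1 hta hS

end LawDec

end Quant

end Summit.CriticalPhenomena.PercolationContinuityZ3.Theorems
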